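import Literature.Probability.Percolation.PortCount
import Literature.Probability.Percolation.TileDataOfZones
import HarnessLib

/-!
# The owners of the hub contacts of the zones' link domain

Topic `Probability/Percolation`.  Support file (proofs only, no named fact) for step (C) of the
proof of Schramm–Smirnov's Prop. 4.1 (Ann. Probab. 39 (2011), §4), joining the abstract tile-domain
results (`PortOwners`, `PortRuns`, `PortCount`) to the zones of the gluing argument
(`TileDataOfZones`).  For zones WITHOUT excised squares (`𝒵.SQ = ∅`: the deterministic closed
boxes of the modified configuration are placed inside the collar `K`), at terminal data of the
seeded collar exploration the tile data `𝒵.tileData` satisfy the hypotheses of the counting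
theorem: every vertex outside the window is a hub vertex (`tileData_farO`), every edge leaving the
window is examined (`tileData_examined_of_leaving`), the terminality package `TileData.Terminal`
(`tileData_terminal`), and the far-connection hypothesis of the chord and pocket lemmas
(`tileData_hfar`: two far vertices are joined through far vertices, going around a box containing
the window).  Hence `exists_owners_zones`: the hub contacts of a traced boundary loop of the link
domain have at most `max 1 (2 · #landings)` owners.

## References

* O. Schramm, S. Smirnov, *On the scaling limits of planar percolation*, Ann. Probab. 39 (2011)
  1768–1814, arXiv:1101.5820, §4, proof of Prop. 4.1. [SchrammSmirnov2011]
-/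

noncomputable section

open Set Relation
open Literature.Probability.LatticeModels
open scoped Classical

namespace Literature.Probability.Percolation

/-! ### The complement of a box in `ℤ²` is connected -/

namespace CellComplex

/-- Walking `n` unit steps in direction `k` inside a set stable along the way. [folklore] -/
theorem reflTransGen_line (P : Site 2 → Prop) (a : Site 2) (k : Fin 4) (n : ℕ)
    (hP : ∀ j : ℕ, j ≤ n → P (a + (j : ℤ) • cornerUnit k)) :
    ReflTransGen (fun x y : Site 2 => P x ∧ P y ∧ (zdGraph 2).Adj x y) a (a + (n : ℤ) • cornerUnit k) := by
  induction n with
  | zero => simpa using ReflTransGen.refl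
  | succ n ih =>
    refine (ih fun j hj => hP j (by omega)).tail ⟨hP n (by omega), ?_, ?_⟩
    · exact_mod_cast hP (n + 1) le_rfl
    · rw [adj_iff_exists_cornerUnit]
      exact ⟨k, by push_cast; rw [add_smul, one_smul, add_assoc]⟩

/-- Changing one coordinate monotonically inside a set stable along the way. [folklore] -/
theorem reflTransGen_update (P : Site 2 → Prop) (a : Site 2) (i : Fin 2) (t : ℤ)
    (hP : ∀ s : ℤ, P (Function.update a i s)) :
    ReflTransGen (fun x y : Site 2 => P x ∧ P y ∧ (zdGraph 2).Adj x y) a (Function.update a i t) := by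
  -- the unit vector of coordinate `i` and its opposite among the `cornerUnit`s
  obtain ⟨k, hk⟩ : ∃ k : Fin 4, cornerUnit k = Pi.single i 1 := by
    fin_cases i
    · exact ⟨0, rfl⟩
    · exact ⟨1, rfl⟩
  have hupd : ∀ s : ℤ, Function.update a i s = a + (s - a i) • (Pi.single i 1 : Site 2) := by
    intro s; funext j
    by_cases hj : j = i
    · subst hj; simp
    · simp [hj]
  rcases le_or_gt (a i) t with h | h
  · -- move in direction `k`
    have := reflTransGen_line P a k (t - a i).toNat (fun j _ => by
      have : a + (j : ℤ) • cornerUnit k = Function.update a i (a i + j) := by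
        rw [hupd, hk]; congr 1; ring_nf
      rw [this]; exact hP _)
    rwa [hk, Int.toNat_of_nonneg (by omega), ← hupd] at this
  · -- move in direction `k + 2`
    have hk2 : cornerUnit (k + 2) = -(Pi.single i 1 : Site 2) := by rw [cornerUnit_add_two, hk]
    have := reflTransGen_line P a (k + 2) (a i - t).toNat (fun j _ => by
      have : a + (j : ℤ) • cornerUnit (k + 2) = Function.update a i (a i - j) := by
        rw [hupd, hk2, smul_neg, ← neg_smul]; congr 1; ring_nf
      rw [this]; exact hP _)
    rwa [hk2, Int.toNat_of_nonneg (by omega), smul_neg, ← neg_smul, show -((a i - t : ℤ)) = t - a i by ring,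
      ← hupd] at this

/-- Outside the box `[-R, R]²`. [folklore] -/
def OutsideBox (R : ℤ) (a : Site 2) : Prop := R < |a 0| ∨ R < |a 1|

/-- **Every site outside a box is joined to the corner `(R+1, R+1)` through sites outside the box.**
[folklore] -/
theorem reflTransGen_outsideBox_corner {R : ℤ} (hR : 0 ≤ R) {v : Site 2} (hv : OutsideBox R v) :
    ReflTransGen (fun x y : Site 2 => OutsideBox R x ∧ OutsideBox R y ∧ (zdGraph 2).Adj x y) v (fun _ => R + 1) := by
  have hR1 : R < |R + 1| := by rw [abs_of_nonneg (by omega)]; omega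
  rcases hv with h0 | h1
  · -- coordinate 1 to `R+1` (coordinate 0 stays large), then coordinate 0 to `R+1`
    have leg1 := reflTransGen_update (OutsideBox R) v 1 (R + 1) (fun s => Or.inl (by simpa using h0))
    have leg2 := reflTransGen_update (OutsideBox R) (Function.update v 1 (R + 1)) 0 (R + 1)
      (fun s => Or.inr (by simp [hR1]))
    convert leg1.trans leg2 using 1
    funext j; fin_cases j <;> simp
  · have leg1 := reflTransGen_update (OutsideBox R) v 0 (R + 1) (fun s => Or.inr (by simpa using h1))
    have leg2 := reflTransGen_update (OutsideBox R) (Function.update v 0 (R + 1)) 1 (R + 1)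
      (fun s => Or.inl (by simp [hR1]))
    convert leg1.trans leg2 using 1
    funext j; fin_cases j <;> simp

/-- **The complement of a box is connected.** [folklore] -/
theorem reflTransGen_outsideBox {R : ℤ} (hR : 0 ≤ R) {v w : Site 2} (hv : OutsideBox R v) (hw : OutsideBox R w) :
    ReflTransGen (fun x y : Site 2 => OutsideBox R x ∧ OutsideBox R y ∧ (zdGraph 2).Adj x y) v w := by
  have symm : ∀ {a b : Site 2}, ReflTransGen (fun x y : Site 2 => OutsideBox R x ∧ OutsideBox R y ∧ (zdGraph 2).Adj x y) a b →
      ReflTransGen (fun x y : Site 2 => OutsideBox R x ∧ OutsideBox R y ∧ (zdGraph 2).Adj x y) b a := by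
    intro a b h
    induction h with
    | refl => exact ReflTransGen.refl
    | tail _ hs ih => exact ReflTransGen.head ⟨hs.2.1, hs.1, hs.2.2.symm⟩ ih
  exact (reflTransGen_outsideBox_corner hR hv).trans (symm (reflTransGen_outsideBox_corner hR hw))

/-- A site of large norm is outside the box. [folklore] -/
theorem outsideBox_of_norm_lt {R : ℤ} (hR : 0 ≤ R) {v : Site 2} (hv : 2 * ((R : ℝ) + 1) < ‖Site.toComplex v‖) :
    OutsideBox R v := by
  by_contra h
  simp only [OutsideBox, not_or, not_lt] at h
  have h0 : |((v 0 : ℤ) : ℝ)| ≤ R := by exact_mod_cast h.1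
  have h1 : |((v 1 : ℤ) : ℝ)| ≤ R := by exact_mod_cast h.2
  have : ‖Site.toComplex v‖ ≤ |((v 0 : ℤ) : ℝ)| + |((v 1 : ℤ) : ℝ)| := by
    simpa [Site.toComplex] using Complex.norm_le_abs_re_add_abs_im (Site.toComplex v)
  have hR' : (0 : ℝ) ≤ R := by exact_mod_cast hR
  linarith

end CellComplex

/-! ### The zones without squares satisfy the hypotheses of the counting theorem -/

namespace Seeded

namespace Zones

open CellComplex

variable (𝒵 : Zones) {X : Finset (Sym2 (Site 2))} {ω : BondConfig (Site 2)}
  (hT : IsTerminal 𝒵.seeds X ω) (hN : 𝒵.Nice) (hSQ : 𝒵.SQ = ∅)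

include hSQ in
/-- Without squares, a vertex outside the window is far. [folklore] -/
theorem mem_Far_of_not_mem_Wv {u : Site 2} (hu : u ∉ 𝒵.Wv) : u ∈ 𝒵.Far :=
  ⟨fun h => hu (Or.inl h), fun h => hu (Or.inr h), by simp [hSQ]⟩

include hSQ in
/-- **Every vertex outside the window is a hub vertex.** [folklore] -/
theorem tileData_farO : ∀ u, u ∉ (𝒵.tileData hT hN).Wv → u ∈ (𝒵.tileData hT hN).O :=
  fun _ hu => oReach_of_mem_seeds X ω (𝒵.mem_Far_of_not_mem_Wv hSQ hu)

include hSQ in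
/-- **Every edge leaving the window is examined** (terminality: it is examinable, with a far hub
endpoint and wet faces). [folklore] -/
theorem tileData_examined_of_leaving : ∀ e ∈ (zdGraph 2).edgeSet, (∃ v ∈ e, v ∈ (𝒵.tileData hT hN).Wv) →
    (∃ u ∈ e, u ∉ (𝒵.tileData hT hN).Wv) → e ∈ (𝒵.tileData hT hN).hubE ∨ e ∈ (𝒵.tileData hT hN).clE := by
  rintro e heE ⟨v, hve, hvW⟩ ⟨u, hue, huW⟩
  have huF : u ∈ 𝒵.Far := 𝒵.mem_Far_of_not_mem_Wv hSQ huW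
  have hvu : v ≠ u := fun h => huW (h ▸ hvW)
  have he : e = s(v, u) := (Sym2.mem_and_mem_iff hvu).1 ⟨hve, hue⟩
  -- `v ∈ K`: a tube site has no far neighbour
  have hvK : v ∈ 𝒵.K := by
    rcases hvW with hK | hvN
    · exact hK
    · exfalso
      have hadj : (zdGraph 2).Adj v u := (SimpleGraph.mem_edgeSet (G := zdGraph 2)).1 (he ▸ heE)
      obtain ⟨k, rfl⟩ := adj_iff_exists_cornerUnit.1 hadj
      rcases hN.N_nbr v hvN k with h | h | h
      · exact huW (Or.inl h)
      · exact huW (Or.inr h)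
      · simp [hSQ] at h
  have heA : e ∈ 𝒵.collar.A := by
    refine 𝒵.collar.mem_A_iff.2 ⟨heE, ⟨v, hve, hvK⟩, fun w hw => ?_⟩
    rw [he] at hw
    rcases Sym2.mem_iff.1 hw with rfl | rfl
    · exact Or.inl hvK
    · exact Or.inr huF
  by_cases heX : e ∈ X
  · by_cases heω : e ∈ ω
    · exact Or.inl ⟨heX, heω⟩
    · exact Or.inr ⟨heX, heω⟩
  · exfalso
    refine hT.not_eligible e ⟨heA, heX, ⟨u, hue, oReach_of_mem_seeds X ω huF⟩, ?_⟩
    obtain ⟨a, b, -, hab⟩ := exists_dualEdge_eq_mk heE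
    refine ⟨a, isFaceOf_left_of_dualEdge_eq hab, dReach_of_mem_seeds X ω ?_⟩
    exact ⟨u, touchesFace_of_isFaceOf heE (isFaceOf_left_of_dualEdge_eq hab) hue, huF⟩

/-- Examined open and examined closed edges are disjoint. [folklore] -/
theorem tileData_hdisj : ∀ e ∈ (𝒵.tileData hT hN).hubE, e ∉ (𝒵.tileData hT hN).clE :=
  fun _ h h' => h'.2 h.2

include hSQ in
/-- **The terminality package of the tile data of the zones without squares.** [folklore] -/
theorem tileData_terminal : (𝒵.tileData hT hN).Terminal where
  far_wet v f hvO hvW hvf := dReach_of_mem_seeds X ω ⟨v, hvf, 𝒵.mem_Far_of_not_mem_Wv hSQ hvW⟩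
  dry_finite := by
    refine (Finset.finite_toSet (𝒵.K ∪ 𝒵.N)).subset fun f hf => ?_
    -- a dry face is its own lower-left corner, a window vertex
    by_contra hfW
    have hfW' : f ∉ 𝒵.Wv := by
      rintro (h | h)
      · exact hfW (Finset.mem_union_left _ h)
      · exact hfW (Finset.mem_union_right _ h)
    refine hf (dReach_of_mem_seeds X ω ⟨f, ?_, 𝒵.mem_Far_of_not_mem_Wv hSQ hfW'⟩)
    have h := TileData.touchesFace_add_cornerOff f 0
    rwa [show cornerOff 0 = 0 from rfl, add_zero] at h
  wet_dry e heE hO hwet hdry := by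
    by_cases heX : e ∈ X
    · by_cases heω : e ∈ ω
      · exact Or.inl ⟨heX, heω⟩
      · exact Or.inr (Or.inl ⟨heX, heω⟩)
    right; right
    by_cases heA : e ∈ 𝒵.collar.A
    · exact absurd ⟨heA, heX, hO, hwet⟩ (hT.not_eligible e)
    · -- not examinable: an endpoint in the tube (which carries a tube edge), or both endpoints far
      by_cases hNe : ∃ w ∈ e, w ∈ 𝒵.N
      · obtain ⟨w, hwe, hwN⟩ := hNe
        refine ⟨w, hwe, 𝒵.not_oReach_of_mem_N hT hwN, Or.inr ?_⟩
        -- the tube edge `{w, w + e₀}` is accessible and fresh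
        have ht : dartEdge w 0 ∈ 𝒵.tubeEdges :=
          𝒵.mem_tubeEdges_iff.2 ⟨dartEdge_mem_edgeSet _ _, ⟨w, mem_dartEdge_iff.2 (Or.inl rfl), hwN⟩,
            fun v _ => by simp [hSQ]⟩
        refine ⟨dartEdge w 0, Finset.mem_filter.2 ⟨𝒵.mem_fresh_iff.2 (Or.inr ht), 𝒵.acc_of_mem_tubeEdges ht⟩,
          mem_dartEdge_iff.2 (Or.inl rfl)⟩
      · push Not at hNe
        exfalso
        -- all endpoints in `K ∪ Far` and none in `K`: all far, so every face is wet
        have hKF : ∀ w ∈ e, w ∈ 𝒵.K ∨ w ∈ 𝒵.Far := by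
          intro w hw
          by_cases hK : w ∈ 𝒵.K
          · exact Or.inl hK
          · exact Or.inr ⟨hK, hNe w hw, by simp [hSQ]⟩
        have hnoK : ∀ w ∈ e, w ∉ 𝒵.K := by
          intro w hw hwK
          exact heA (𝒵.collar.mem_A_iff.2 ⟨heE, ⟨w, hw, hwK⟩, hKF⟩)
        obtain ⟨m, hme, hmD⟩ := hdry
        refine hmD (dReach_of_mem_seeds X ω ?_)
        obtain ⟨w, hw⟩ : ∃ w, w ∈ e := ⟨_, Sym2.out_fst_mem e⟩
        exact ⟨w, touchesFace_of_isFaceOf heE hme hw, (hKF w hw).resolve_left (hnoK w hw)⟩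
  esc_dry f _ w _ hwW hwO := absurd (𝒵.tileData_farO hT hN hSQ w hwW) hwO

include hSQ in
/-- **The far connection**: two vertices outside the window are joined through vertices outside
the window (around a box containing the window), all of which are hub vertices. [folklore] -/
theorem tileData_hfar : ∀ c c' u₁ u₂ : Site 2, c ∈ (𝒵.tileData hT hN).O → c' ∈ (𝒵.tileData hT hN).O →
    (∃ f, TouchesFace c f ∧ TouchesFace c' f) → u₁ ∉ (𝒵.tileData hT hN).Wv → u₂ ∉ (𝒵.tileData hT hN).Wv →
    ReflTransGen (fun a b => s(a, b) ∈ (𝒵.tileData hT hN).hubE) c u₁ →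
    ReflTransGen (fun a b => s(a, b) ∈ (𝒵.tileData hT hN).hubE) c' u₂ →
    ReflTransGen (TileData.FarAdj (𝒵.tileData hT hN)) u₂ u₁ := by
  intro c c' u₁ u₂ _ _ _ hu₁ hu₂ _ _
  set 𝒯 := 𝒵.tileData hT hN with h𝒯
  have hWv : 𝒯.Wv = 𝒵.Wv := rfl
  -- steps between vertices outside the window are `FarAdj` steps
  have farStep : ∀ {a b : Site 2}, a ∉ 𝒵.Wv → b ∉ 𝒵.Wv → (zdGraph 2).Adj a b → TileData.FarAdj 𝒯 a b :=
    fun ha hb hab => ⟨hab, 𝒵.tileData_farO hT hN hSQ _ ha, ha, 𝒵.tileData_farO hT hN hSQ _ hb, hb⟩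
  -- a box containing the window
  set R : ℕ := (𝒵.K ∪ 𝒵.N).sup fun v => max (|v 0|).toNat (|v 1|).toNat with hR
  have hbox : ∀ v : Site 2, OutsideBox (R : ℤ) v → v ∉ 𝒵.Wv := by
    intro v hv hvW
    have hmem : v ∈ 𝒵.K ∪ 𝒵.N := by
      rcases hvW with h | h
      · exact Finset.mem_union_left _ h
      · exact Finset.mem_union_right _ h
    have hle : max (|v 0|).toNat (|v 1|).toNat ≤ R := Finset.le_sup (f := fun v : Site 2 => max (|v 0|).toNat (|v 1|).toNat) hmem
    rcases hv with h | h
    · have : (|v 0|).toNat ≤ R := (le_max_left _ _).trans hle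
      omega
    · have : (|v 1|).toNat ≤ R := (le_max_right _ _).trans hle
      omega
  -- escape far away from `u₁` and `u₂`
  have esc : ∀ u, u ∉ 𝒵.Wv → ∃ u', OutsideBox (R : ℤ) u' ∧ ReflTransGen (TileData.FarAdj 𝒯) u u' ∧
      ReflTransGen (TileData.FarAdj 𝒯) u' u := by
    intro u hu
    obtain ⟨u', hnorm, hpath⟩ := hN.W_esc u (fun h => hu (Or.inl h)) (fun h => hu (Or.inr h)) (2 * ((R : ℝ) + 1))
    have hout : OutsideBox (R : ℤ) u' := outsideBox_of_norm_lt (by positivity) (by push_cast; exact hnorm)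
    refine ⟨u', hout, ?_, ?_⟩
    · clear hnorm hout
      induction hpath with
      | refl => exact ReflTransGen.refl
      | @tail a b _ hab ih =>
        obtain ⟨⟨haK, haN⟩, ⟨hbK, hbN⟩, k, rfl⟩ := hab
        exact ih.tail (farStep (by rintro (h | h) <;> contradiction) (by rintro (h | h) <;> contradiction)
          (adj_iff_exists_cornerUnit.2 ⟨k, rfl⟩))
    · clear hnorm hout
      induction hpath with
      | refl => exact ReflTransGen.refl
      | @tail a b _ hab ih =>
        obtain ⟨⟨haK, haN⟩, ⟨hbK, hbN⟩, k, rfl⟩ := hab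
        refine ReflTransGen.head (farStep (b := a) ?_ ?_ (adj_iff_exists_cornerUnit.2 ⟨k, rfl⟩).symm) ih
        · rintro (h | h) <;> contradiction
        · rintro (h | h) <;> contradiction
  obtain ⟨u₁', h₁out, -, h₁back⟩ := esc u₁ hu₁
  obtain ⟨u₂', h₂out, h₂go, -⟩ := esc u₂ hu₂
  -- around the box
  have hmid : ReflTransGen (TileData.FarAdj 𝒯) u₂' u₁' := by
    have h := reflTransGen_outsideBox (R := (R : ℤ)) (by positivity) h₂out h₁out
    clear h₁back h₂go h₁out h₂out
    induction h with
    | refl => exact ReflTransGen.refl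
    | tail _ hab ih => exact ih.tail (farStep (hbox _ hab.1) (hbox _ hab.2.1) hab.2.2)
  exact (h₂go.trans hmid).trans h₁back

include hSQ in
/-- **The owners of the hub contacts of the zones' link domain are few**: at most
`max 1 (2 · #landings)` hubs own all the hub contacts of a traced boundary loop of the link domain.
[cite: SchrammSmirnov2011, §4, proof of Prop. 4.1 ("the number of bays is bounded")] -/
theorem exists_owners_zones {d₀ : Site 2 × Fin 4} (h₀ : IsBd (𝒵.tileData hT hN).U d₀) :
    ∃ R : Finset (Site 2), R.card ≤ max 1 (2 * ((𝒵.tileData hT hN).landings).card) ∧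
      ∀ i, (𝒵.tileData hT hN).hubContact d₀ i → ∀ v ∈ (𝒵.tileData hT hN).att ((𝒵.tileData hT hN).outCell d₀ i),
        ∃ r ∈ R, (𝒵.tileData hT hN).HubConn v r :=
  TileData.exists_owners h₀ (𝒵.tileData_terminal hT hN hSQ) (𝒵.tileData_farO hT hN hSQ)
    (𝒵.tileData_examined_of_leaving hT hN hSQ) (𝒵.tileData_hdisj hT hN) (𝒵.tileData_hfar hT hN hSQ)

end Zones

end Seeded

end Literature.Probability.Percolation

end
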